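import Mathlib.Probability.ProbabilityMassFunction.Constructions
import Mathlib.Probability.Distributions.Uniform
import Mathlib.Data.Matrix.Mul
import Mathlib.Data.ZMod.Basic
import HarnessLib

-- provenance: harness21/H21/H21/Prelude/Lattice/LWE.lean @ 12e2ffd (interim HEAD d8f2665); M5 mechanical rewrite
/-!
# The LWE distribution (trunk T-LATTICE, G10)

The *Learning With Errors* sample distribution `A_{s,χ}` of Regev (2009, §2), stated generically over a
finite commutative ring `R` (design D2 of the outline; only `[CommRing R] [Fintype R]` is
assumed, `DecidableEq R` being needed only for the joint search experiment): a sample is `(a, ⟨a, s⟩ + e)` with `a` uniform in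
`ι → R` and `e ← χ`.  Plain LWE is `R = ZMod q`, `ι = Fin n`; Module-LWE takes `R = 𝓞 K ⧸ q`,
`ι = Fin d`; normal-form Ring-LWE takes `ι = Fin 1`.

We also provide the `m`-fold product `lweSamples`, the uniform reference distribution `uniformSamples`,
the types of search solvers / decision distinguishers (Markov kernels into `PMF`), and the success /
advantage functionals consumed by the `pqc` statement files (Regev 2009 §4; Peikert 2016 §4.2).

## Mathlib

Mathlib has `PMF`, `PMF.bind`, `PMF.map`, `PMF.uniformOfFintype`, `dotProduct` (notation `⬝ᵥ`), all used
here.  Mathlib has *no* finite product / iid construction on `PMF` (nothing in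
`Mathlib/Probability/ProbabilityMassFunction/`), so we define `Literature.Computability.Cryptography.LWE.iidPMF` locally (in our namespace,
not as `PMF.iid`, to avoid root-namespace clashes with other trunks).

## Design

* All types live in `Type` (not `Type*`) so that `PMF.bind` stays in a single universe.
* `distinguishingAdvantage` is the standard *average-case* decision-LWE advantage (secret uniform inside the
  LWE branch).  Regev's Lemma 4.1 passes through a worst-case / "non-negligible fraction of `s`"
  intermediate; that refinement is recorded in the docstring of `pqc.S22`, not here.

## References

* O. Regev, *On lattices, learning with errors, random linear codes, and cryptography*, J. ACM 56 (2009),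
  §2 and §4.
* C. Peikert, *A decade of lattice cryptography*, Found. Trends TCS 10 (2016), §4.2.
-/

noncomputable section

open scoped ENNReal

namespace Literature.Computability.Cryptography

namespace LWE

/-! ### iid products of a `PMF` -/

/-- The `m`-fold iid product of a probability mass function `p`: the law of `(X₀, …, X_{m-1})` with the
`Xᵢ` independent of law `p`, as a `PMF` on `Fin m → α`.  Defined by recursion on `m` (`Fin.cons` of a fresh
sample onto the product of `m` samples).  Mathlib has no product `PMF`; cf. Regev 2009 §2 ("`m` independent
samples from `A_{s,χ}`"). [cite: Regev2009, §2 (" m  independent samples from  A_{s] -/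
def iidPMF {α : Type} (p : PMF α) : (m : ℕ) → PMF (Fin m → α)
  | 0 => PMF.pure Fin.elim0
  | m + 1 => p.bind fun x ↦ (iidPMF p m).map fun v ↦ Fin.cons x v

/-- `iidPMF p 0` is the Dirac mass at the empty tuple. [folklore] -/
@[simp]
theorem iidPMF_zero {α : Type} (p : PMF α) : iidPMF p 0 = PMF.pure Fin.elim0 := rfl

/-- Unfolding equation for `iidPMF p (m + 1)`. [folklore] -/
theorem iidPMF_succ {α : Type} (p : PMF α) (m : ℕ) :
    iidPMF p (m + 1) = p.bind fun x ↦ (iidPMF p m).map fun v ↦ Fin.cons x v := rfl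

/-- Product formula: the iid product assigns mass `∏ i, p (v i)` to the tuple `v` (independence;
Regev 2009 §2). [cite: Regev2009, §2] -/
def iidPMF_apply : Prop :=
  ∀ {α : Type} (p : PMF α) (m : ℕ) (v : Fin m → α),
    iidPMF p m v = ∏ i, p (v i)

/-! ### The LWE sample distribution -/

variable {ι : Type} [Fintype ι] [DecidableEq ι]
variable {R : Type} [CommRing R] [Fintype R]

/-- The LWE distribution `A_{s,χ}` on `(ι → R) × R`: sample `a` uniformly from `ι → R`, `e ← χ`, and
output `(a, a ⬝ᵥ s + e)` (Regev 2009 §2, with `R = ZMod q`, `ι = Fin n`; Peikert 2016 Def. 4.2.1). [cite: Regev2009, §2  with  R = ZMod q    ι = Fin n] -/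
def lweSample (χ : PMF R) (s : ι → R) : PMF ((ι → R) × R) :=
  (PMF.uniformOfFintype (ι → R)).bind fun a ↦ χ.map fun e ↦ (a, a ⬝ᵥ s + e)

/-- Mass of a single LWE sample: `A_{s,χ}(a, b) = |R|^{-|ι|} · χ(b - ⟨a, s⟩)` (Regev 2009 §2). [cite: Regev2009, §2] -/
def lweSample_apply : Prop :=
  ∀ (χ : PMF R) (s : ι → R) (a : ι → R) (b : R),
    lweSample χ s (a, b) = ((Fintype.card R : ℝ≥0∞) ^ Fintype.card ι)⁻¹ * χ (b - a ⬝ᵥ s)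

/-- The first marginal of `A_{s,χ}` is uniform on `ι → R` (Regev 2009 §2). [cite: Regev2009, §2] -/
def lweSample_map_fst : Prop :=
  ∀ (χ : PMF R) (s : ι → R),
    (lweSample χ s).map Prod.fst = PMF.uniformOfFintype (ι → R)

/-- `m` independent samples from `A_{s,χ}` (Regev 2009 §2: the input of an LWE solver). [cite: Regev2009, §2: the input of an LWE solver] -/
def lweSamples (χ : PMF R) (s : ι → R) (m : ℕ) : PMF (Fin m → (ι → R) × R) :=
  iidPMF (lweSample χ s) m

variable (ι R) in
/-- `m` independent uniform samples from `(ι → R) × R`: the reference distribution of decision-LWE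
(Regev 2009 §4). [cite: Regev2009, §4] -/
def uniformSamples (m : ℕ) : PMF (Fin m → (ι → R) × R) :=
  PMF.uniformOfFintype (Fin m → (ι → R) × R)

/-- `uniformSamples` is the iid product of the uniform distribution on one sample. [cite: RegevLWE2009, §2] -/
def uniformSamples_eq_iidPMF : Prop :=
  ∀ (m : ℕ),
    uniformSamples ι R m = iidPMF (PMF.uniformOfFintype ((ι → R) × R)) m

/-! ### Solvers, distinguishers and their success functionals -/

variable (ι R) in
/-- A (randomised) search-LWE solver on `m` samples: a Markov kernel from sample tuples to guesses for the
secret.  Machine models (Turing machines, quantum circuits) are instantiated to this type in the `pqc`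
statement files (Regev 2009 §4). [cite: Regev2009, §4] -/
abbrev Solver (m : ℕ) : Type := (Fin m → (ι → R) × R) → PMF (ι → R)

variable (ι R) in
/-- A (randomised) decision-LWE distinguisher on `m` samples: a Markov kernel from sample tuples to a
Boolean verdict (Regev 2009 §4). [cite: Regev2009, §4] -/
abbrev Distinguisher (m : ℕ) : Type := (Fin m → (ι → R) × R) → PMF Bool

/-- Success probability of the search solver `A` against the fixed secret `s`:
`Pr[A(samples) = s]` with `samples ← A_{s,χ}^m` (Regev 2009 §4). [cite: Regev2009, §4] -/
def searchSuccessProbOf (χ : PMF R) (m : ℕ) (A : Solver ι R m) (s : ι → R) : ℝ≥0∞ :=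
  ((lweSamples χ s m).bind A) s

/-- Average-case success probability of the search solver `A`: the average over a uniform secret `s` of
`searchSuccessProbOf χ m A s` (Regev 2009 §4, the quantity bounded in the search-LWE assumption). [cite: Regev2009, §4  the quantity bounded in the search-L] -/
def searchSuccessProb (χ : PMF R) (m : ℕ) (A : Solver ι R m) : ℝ≥0∞ :=
  ∑ s, PMF.uniformOfFintype (ι → R) s * searchSuccessProbOf χ m A s

/-- The joint search-LWE experiment: draw `s` uniformly, `m` samples from `A_{s,χ}`, run `A`, and record
whether the guess equals `s` (Regev 2009 §4). [cite: Regev2009, §4] -/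
def searchExperiment [DecidableEq R] (χ : PMF R) (m : ℕ) (A : Solver ι R m) : PMF Bool :=
  (PMF.uniformOfFintype (ι → R)).bind fun s ↦
    ((lweSamples χ s m).bind A).map fun s' ↦ decide (s' = s)

/-- The averaged success probability equals the success probability of the joint experiment. [cite: RegevLWE2009, §4 (search/decision LWE experiments)] -/
def searchSuccessProb_eq_searchExperiment : Prop :=
  ∀ [DecidableEq R] (χ : PMF R) (m : ℕ) (A : Solver ι R m),
    searchSuccessProb χ m A = searchExperiment χ m A true

/-- Discharge of `searchSuccessProb_eq_searchExperiment`: averaging the per-secret success probability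
`Pr[A(A_{s,χ}^m) = s]` over a uniform secret `s` gives the success probability of the joint experiment
(`s ← U`, samples `← A_{s,χ}^m`, guess `← A`, test `guess = s`).  Elementary: unfold `PMF.bind`/`PMF.map`
and collapse the inner sum over guesses to the single term `s' = s` (Regev 2009 §4, p. 23, the averaging
implicit in Lemma 4.1 "Average-case to Worst-case"). [cite: RegevLWE2009, §4 (Lemma 4.1, p. 23)] -/
theorem searchSuccessProb_eq_searchExperiment_holds :
    searchSuccessProb_eq_searchExperiment (ι := ι) (R := R) := by
  intro _ χ m A
  unfold searchSuccessProb searchExperiment searchSuccessProbOf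
  rw [PMF.bind_apply, tsum_fintype]
  refine Finset.sum_congr rfl fun s _ ↦ ?_
  congr 1
  rw [PMF.map_apply, tsum_eq_single s]
  · simp
  · intro s' hs'
    simp [hs']

/-- A success probability is at most `1`. [folklore] -/
theorem searchSuccessProbOf_le_one (χ : PMF R) (m : ℕ) (A : Solver ι R m) (s : ι → R) :
    searchSuccessProbOf χ m A s ≤ 1 :=
  PMF.coe_le_one _ _

/-- The average-case success probability is at most `1`. [cite: RegevLWE2009, §4 (search/decision LWE experiments)] -/
def searchSuccessProb_le_one : Prop :=
  ∀ (χ : PMF R) (m : ℕ) (A : Solver ι R m),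
    searchSuccessProb χ m A ≤ 1

/-- Acceptance probability of a Boolean-valued kernel `D` on inputs drawn from `P`:
`Pr[D(x) = true]`, `x ← P` (Regev 2009 §4). [cite: Regev2009, §4] -/
def acceptProb {β : Type} (D : β → PMF Bool) (P : PMF β) : ℝ≥0∞ :=
  (P.bind D) true

/-- An acceptance probability is at most `1`. [folklore] -/
theorem acceptProb_le_one {β : Type} (D : β → PMF Bool) (P : PMF β) : acceptProb D P ≤ 1 :=
  PMF.coe_le_one _ _

/-- Distinguishing advantage of `D` against the fixed secret `s`:
`|Pr[D(A_{s,χ}^m) accepts] - Pr[D(U^m) accepts]|` (Regev 2009 §4, worst-case-in-`s` form). [cite: Regev2009, §4  worst-case-in- s  form] -/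
def distinguishingAdvantageOf (χ : PMF R) (m : ℕ) (D : Distinguisher ι R m) (s : ι → R) : ℝ :=
  |(acceptProb D (lweSamples χ s m)).toReal - (acceptProb D (uniformSamples ι R m)).toReal|

/-- The LWE branch of the decision experiment with a uniformly random secret: `s ← U(ι → R)`, then `m`
samples from `A_{s,χ}` (Regev 2009 §4). [cite: Regev2009, §4] -/
def lweSamplesUniformSecret (χ : PMF R) (m : ℕ) : PMF (Fin m → (ι → R) × R) :=
  (PMF.uniformOfFintype (ι → R)).bind fun s ↦ lweSamples χ s m

/-- The (average-case) decision-LWE distinguishing advantage of `D`: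
`|Pr_{s ← U}[D(A_{s,χ}^m) accepts] - Pr[D(U^m) accepts]|`.  This is the standard average-case advantage
(Regev 2009 §4; Peikert 2016 Def. 4.2.2); Regev's Lemma 4.1 passes through a worst-case /
non-negligible-fraction-of-`s` intermediate, cf. the docstring of `pqc.S22`. [cite: Regev2009, §4] -/
def distinguishingAdvantage (χ : PMF R) (m : ℕ) (D : Distinguisher ι R m) : ℝ :=
  |(acceptProb D (lweSamplesUniformSecret χ m)).toReal - (acceptProb D (uniformSamples ι R m)).toReal|

/-- The average-case advantage is bounded by the average of the per-secret advantages (triangle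
inequality). [cite: PeikertDecade2016, §4.2] -/
def distinguishingAdvantage_le_sum : Prop :=
  ∀ (χ : PMF R) (m : ℕ) (D : Distinguisher ι R m),
    distinguishingAdvantage χ m D ≤
      ∑ s, (PMF.uniformOfFintype (ι → R) s).toReal * distinguishingAdvantageOf χ m D s

/-- A distinguishing advantage is nonnegative. [folklore] -/
theorem distinguishingAdvantage_nonneg (χ : PMF R) (m : ℕ) (D : Distinguisher ι R m) :
    0 ≤ distinguishingAdvantage χ m D :=
  abs_nonneg _

/-- A distinguishing advantage is at most `1`. [cite: PeikertDecade2016, §4.2] -/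
def distinguishingAdvantage_le_one : Prop :=
  ∀ (χ : PMF R) (m : ℕ) (D : Distinguisher ι R m),
    distinguishingAdvantage χ m D ≤ 1

/-- With uniform noise the LWE distribution *is* uniform, so its first coordinate carries no information:
`A_{s,U}` is the uniform distribution on `(ι → R) × R`. [cite: RegevLWE2009, §4 (uniform noise gives the uniform distribution)] -/
def lweSample_uniformOfFintype : Prop :=
  ∀ (s : ι → R),
    lweSample (PMF.uniformOfFintype R) s = PMF.uniformOfFintype ((ι → R) × R)

/-- With uniform noise every distinguisher has advantage `0` (sanity check: `A_{s,U}^m = U^m`). [cite: RegevLWE2009, §4] -/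
def distinguishingAdvantage_uniform_eq_zero : Prop :=
  ∀ (m : ℕ) (D : Distinguisher ι R m),
    distinguishingAdvantage (PMF.uniformOfFintype R) m D = 0

end LWE

end Literature.Computability.Cryptography

end
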